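import Mathlib
import Summits.NavierStokesRegularity.NavierStokesRegularity.Theorems.RotatedEulerWindowDecayFluxRecurrenceLiouville
import Literature.Analysis.FluidPDE.VectorCalculus
import HarnessLib

/-!
# First integrals of the similarity flow are determined at infinity
  (stub S1 `stub_similarityFirstIntegralRigidity` = `SimilarityFirstIntegralRigidity` of the registered
  skeleton `Cruxes/EulerLerayLiouville/Lines/birth.lean` of crux `AffineBernoulli.EulerLerayLiouville`,
  stmt-NavierStokesRegularity-13660; also the swirl-extinction step of support item
  `AffineBernoulli.AxisymDecayingSwirlLiouville`, stmt-NavierStokesRegularity-13905)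

**Statement** (`Summit…Theorems.similarityFirstIntegralRigidity`, the registered signature verbatim).
For a centre `c` and a `C¹`, divergence-free `W : ℝ³ → ℝ³` with the `𝓔½` far field
(`‖W y‖ ≤ C(1+‖y‖)⁻¹`, `‖DW y‖ ≤ C((1+‖y‖)²)⁻¹`), every differentiable `f : ℝ³ → ℝ` which is a first
integral of the similarity field `V = ½(y−c) + W` (`Df(y)[V y] = 0`) and tends to `h` at infinity is
identically `h`.

PROOF (the skeleton's plan). `V` is `C¹` with `‖DV‖ ≤ ½ + C`, hence globally Lipschitz: its flow `Ψ`
is complete (`Literature.Analysis.ODE.lipschitzFlow`). (1) `t ↦ f (Ψ q t)` has derivative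
`Df[V] = 0`, so `f` is constant on orbits. (2) OUTWARD FAR FIELD: `2⟪y−c, V y⟫ ≥ ‖y−c‖² − 2B`,
`B = C(1+‖c‖)`, so `(‖Ψ q t − c‖² − 2B)e^{−t}` is non-decreasing; an orbit that is ever outside the
closed ball `‖y − c‖² ≤ 2B + 1` runs to infinity, and then `f q = lim f(Ψ q t) = h`. (3) The set
`Inv` of points whose forward orbit never leaves that ball is closed, bounded and forward invariant;
`div V = 3/2`, so by Liouville (tools file `RotatedEulerWindowDecayFluxRecurrenceLiouville`:
`det DΨ_T = e^{3T/2}`, area formula) `vol (Ψ_1 '' Inv) = e^{3/2} vol Inv ≤ vol Inv < ∞` forces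
`vol Inv = 0`. (4) A closed null set has empty interior, so `Invᶜ` is dense, `f = h` there, and `f` is
continuous: `f ≡ h`.

References: V. I. Arnold, B. Khesin, *Topological Methods in Hydrodynamics*, Ch. II §1;
Chae–Wolf, arXiv:1901.09426, §2.3 (the swirl case).

HONEST FRAMING: an ODE/measure lemma about the similarity flow of HYPOTHETICAL self-similar Euler
profiles; nothing here bears on the regularity problem itself.
-/

noncomputable section

set_option linter.dupNamespace false

namespace Summit.NavierStokesRegularity.NavierStokesRegularity.Theorems

open Set Function Filter Topology MeasureTheory Metric
open scoped NNReal ENNReal ContDiff RealInnerProductSpace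
open Literature.Analysis.ODE

namespace DecayFlux

variable {E : Type*} [NormedAddCommGroup E] [NormedSpace ℝ E] [FiniteDimensional ℝ E]
  [CompleteSpace E] [MeasurableSpace E] [BorelSpace E]

/-- **Liouville's theorem with constant divergence**: for `g ∈ C¹` globally Lipschitz with
`tr Dg ≡ d`, the time-`T` map (`T ≥ 0`) of its flow multiplies the volume of every measurable set by
`e^{dT}` (area formula with `det DΨ_T = e^{dT}`). [folklore] -/
theorem addHaar_image_flow_eq_exp_mul (μ : Measure E) [μ.IsAddHaarMeasure] {g : E → E} {K : ℝ≥0}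
    (hK : LipschitzWith K g) (hg : ContDiff ℝ 1 g) {d : ℝ}
    (hdiv : ∀ y, LinearMap.trace ℝ E (fderiv ℝ g y : E →ₗ[ℝ] E) = d) {T : ℝ} (hT : 0 ≤ T)
    {s : Set E} (hs : MeasurableSet s) :
    μ ((fun q => lipschitzFlow hK q T) '' s) = ENNReal.ofReal (Real.exp (d * T)) * μ s := by
  choose J hJ hdet using fun x => exists_hasFDerivAt_flow_det_eq_exp hK hg hdiv hT x
  have h := lintegral_abs_det_fderiv_eq_addHaar_image μ hs
    (fun x _ => (hJ x).hasFDerivWithinAt) (injective_flow_slice hK T).injOn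
  rw [← h]
  simp only [hdet, abs_of_pos (Real.exp_pos _), setLIntegral_const]

/-- **An expanding flow has no bounded forward-invariant set of positive measure**: if
`tr Dg ≡ d > 0` and a measurable set `s` of finite measure satisfies `Ψ_T '' s ⊆ s` for some `T > 0`,
then `μ s = 0`. [folklore] -/
theorem measure_eq_zero_of_image_flow_subset (μ : Measure E) [μ.IsAddHaarMeasure] {g : E → E}
    {K : ℝ≥0} (hK : LipschitzWith K g) (hg : ContDiff ℝ 1 g) {d : ℝ} (hd : 0 < d)
    (hdiv : ∀ y, LinearMap.trace ℝ E (fderiv ℝ g y : E →ₗ[ℝ] E) = d) {T : ℝ} (hT : 0 < T)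
    {s : Set E} (hs : MeasurableSet s) (hfin : μ s ≠ ⊤)
    (hsub : (fun q => lipschitzFlow hK q T) '' s ⊆ s) : μ s = 0 := by
  by_contra h0
  have h1 := addHaar_image_flow_eq_exp_mul μ hK hg hdiv hT.le hs
  have h2 : ENNReal.ofReal (Real.exp (d * T)) * μ s ≤ μ s := h1 ▸ measure_mono hsub
  have hgt : (1 : ℝ≥0∞) < ENNReal.ofReal (Real.exp (d * T)) := by
    rw [← ENNReal.ofReal_one, ENNReal.ofReal_lt_ofReal_iff (Real.exp_pos _)]
    exact Real.one_lt_exp_iff.2 (mul_pos hd hT)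
  have h3 : (1 : ℝ≥0∞) * μ s < ENNReal.ofReal (Real.exp (d * T)) * μ s :=
    (ENNReal.mul_lt_mul_iff_left h0 hfin).2 hgt
  rw [one_mul] at h3
  exact absurd h2 (not_le.2 h3)

end DecayFlux

namespace SimilarityFlow

/-- The outward inequality of the similarity field: for `‖W y‖ ≤ C (1+‖y‖)⁻¹`,
`2⟪y − c, ½(y−c) + W y⟫ ≥ ‖y − c‖² − 2C(1+‖c‖)`. -/
theorem two_inner_ge {c : EuclideanSpace ℝ (Fin 3)}
    {W : EuclideanSpace ℝ (Fin 3) → EuclideanSpace ℝ (Fin 3)} {C : ℝ} (hC : 0 ≤ C)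
    (hW : ∀ y, ‖W y‖ ≤ C * (1 + ‖y‖)⁻¹) (y : EuclideanSpace ℝ (Fin 3)) :
    ‖y - c‖ ^ 2 - 2 * (C * (1 + ‖c‖)) ≤ 2 * ⟪y - c, (1 / 2 : ℝ) • (y - c) + W y⟫ := by
  have h1 : ⟪y - c, (1 / 2 : ℝ) • (y - c) + W y⟫ = (1 / 2) * ‖y - c‖ ^ 2 + ⟪y - c, W y⟫ := by
    rw [inner_add_right, inner_smul_right, real_inner_self_eq_norm_sq]
  have h2 : |⟪y - c, W y⟫| ≤ C * (1 + ‖c‖) := by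
    have hy : 0 < 1 + ‖y‖ := by positivity
    calc |⟪y - c, W y⟫| ≤ ‖y - c‖ * ‖W y‖ := abs_real_inner_le_norm _ _
      _ ≤ (‖y‖ + ‖c‖) * (C * (1 + ‖y‖)⁻¹) :=
          mul_le_mul (norm_sub_le _ _) (hW y) (norm_nonneg _) (by positivity)
      _ = C * ((‖y‖ + ‖c‖) / (1 + ‖y‖)) := by ring
      _ ≤ C * (1 + ‖c‖) := by
          refine mul_le_mul_of_nonneg_left ?_ hC
          rw [div_le_iff₀ hy]
          nlinarith [norm_nonneg y, norm_nonneg c]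
  rw [h1]
  linarith [neg_abs_le ⟪y - c, W y⟫]

end SimilarityFlow

open Literature.Analysis.FluidPDE in
/-- **First integrals of the similarity flow are determined at infinity** (registered stub
`stub_similarityFirstIntegralRigidity` of crux stmt-NavierStokesRegularity-13660, signature verbatim).
For `W ∈ C¹`, divergence free, with `‖W y‖ ≤ C(1+‖y‖)⁻¹` and `‖DW y‖ ≤ C((1+‖y‖)²)⁻¹`, every
differentiable first integral `f` of `V = ½(y−c) + W` which tends to `h` at infinity is identically
`h`: the flow of `V` is complete and expands volume at the constant rate `e^{3t/2}`, so the bounded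
forward-invariant set is a closed Lebesgue-null set and the basin of infinity is dense. [folklore] -/
theorem similarityFirstIntegralRigidity :
    ∀ (c : EuclideanSpace ℝ (Fin 3)) (W : EuclideanSpace ℝ (Fin 3) → EuclideanSpace ℝ (Fin 3))
      (f : EuclideanSpace ℝ (Fin 3) → ℝ) (h : ℝ),
      ContDiff ℝ 1 W → Literature.Analysis.FluidPDE.VectorCalculus.IsDivFree W →
      (∃ C : ℝ, ∀ y, ‖W y‖ ≤ C * (1 + ‖y‖)⁻¹ ∧ ‖fderiv ℝ W y‖ ≤ C * ((1 + ‖y‖) ^ 2)⁻¹) →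
      Differentiable ℝ f →
      (∀ y, fderiv ℝ f y ((1 / 2 : ℝ) • (y - c) + W y) = 0) →
      Filter.Tendsto f (Filter.cocompact (EuclideanSpace ℝ (Fin 3))) (nhds h) →
      ∀ y, f y = h := by
  intro c W f h hW hdiv hdec hf hfV hlim
  obtain ⟨C, hC⟩ := hdec
  have hC0 : 0 ≤ C := by
    have h0 := (hC 0).1
    simp only [norm_zero, add_zero, inv_one, mul_one] at h0
    exact (norm_nonneg _).trans h0
  -- the similarity field `V`, `C¹` and globally Lipschitz
  obtain ⟨V, hV⟩ : ∃ V : EuclideanSpace ℝ (Fin 3) → EuclideanSpace ℝ (Fin 3),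
      V = fun y => (1 / 2 : ℝ) • (y - c) + W y := ⟨_, rfl⟩
  have hVx : ∀ x, V x = (1 / 2 : ℝ) • (x - c) + W x := fun x => by rw [hV]
  have hVC1 : ContDiff ℝ 1 V := by
    rw [hV]; exact ((contDiff_id.sub contDiff_const).const_smul _).add hW
  have hVd : ∀ y, HasFDerivAt V
      ((1 / 2 : ℝ) • ContinuousLinearMap.id ℝ (EuclideanSpace ℝ (Fin 3)) + fderiv ℝ W y) y := by
    intro y
    rw [hV]
    exact (((hasFDerivAt_id y).sub_const c).const_smul (1 / 2 : ℝ)).add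
      ((hW.differentiable (by simp)) y).hasFDerivAt
  have hbound : ∀ y,
      ‖(1 / 2 : ℝ) • ContinuousLinearMap.id ℝ (EuclideanSpace ℝ (Fin 3)) + fderiv ℝ W y‖ ≤
        1 / 2 + C := by
    intro y
    have h1 : ‖fderiv ℝ W y‖ ≤ C := by
      refine ((hC y).2).trans ?_
      have h2 : (1 : ℝ) ≤ (1 + ‖y‖) ^ 2 := by nlinarith [norm_nonneg y]
      calc C * ((1 + ‖y‖) ^ 2)⁻¹ ≤ C * 1 :=
            mul_le_mul_of_nonneg_left (inv_le_one_of_one_le₀ h2) hC0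
        _ = C := mul_one C
    calc ‖(1 / 2 : ℝ) • ContinuousLinearMap.id ℝ (EuclideanSpace ℝ (Fin 3)) + fderiv ℝ W y‖
        ≤ ‖(1 / 2 : ℝ) • ContinuousLinearMap.id ℝ (EuclideanSpace ℝ (Fin 3))‖ + ‖fderiv ℝ W y‖ :=
          norm_add_le _ _
      _ ≤ 1 / 2 + C := by
          refine add_le_add ?_ h1
          rw [norm_smul, Real.norm_eq_abs, abs_of_pos (by norm_num : (0 : ℝ) < 1 / 2)]
          nlinarith [ContinuousLinearMap.norm_id_le (𝕜 := ℝ) (E := EuclideanSpace ℝ (Fin 3))]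
  have hVlip : LipschitzWith (Real.toNNReal (1 / 2 + C)) V := by
    refine lipschitzWith_of_nnnorm_fderiv_le (fun y => (hVd y).differentiableAt) fun y => ?_
    rw [(hVd y).fderiv, ← NNReal.coe_le_coe, coe_nnnorm, Real.coe_toNNReal _ (by positivity)]
    exact hbound y
  -- `div V = 3/2`
  have hVdiv : ∀ y, LinearMap.trace ℝ _
      (fderiv ℝ V y : EuclideanSpace ℝ (Fin 3) →ₗ[ℝ] EuclideanSpace ℝ (Fin 3)) = 3 / 2 := by
    intro y
    rw [(hVd y).fderiv]
    have h1 : LinearMap.trace ℝ _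
        (fderiv ℝ W y : EuclideanSpace ℝ (Fin 3) →ₗ[ℝ] EuclideanSpace ℝ (Fin 3)) = 0 := hdiv y
    have h2 : (((1 / 2 : ℝ) • ContinuousLinearMap.id ℝ (EuclideanSpace ℝ (Fin 3)) + fderiv ℝ W y :
        EuclideanSpace ℝ (Fin 3) →L[ℝ] EuclideanSpace ℝ (Fin 3)) :
        EuclideanSpace ℝ (Fin 3) →ₗ[ℝ] EuclideanSpace ℝ (Fin 3))
        = (1 / 2 : ℝ) • LinearMap.id +
          (fderiv ℝ W y : EuclideanSpace ℝ (Fin 3) →ₗ[ℝ] EuclideanSpace ℝ (Fin 3)) := rfl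
    rw [h2, map_add, map_smul, h1, LinearMap.trace_id, finrank_euclideanSpace_fin]
    norm_num
  -- the complete flow `Ψ` and constancy of `f` on orbits
  obtain ⟨Ψ, hΨ⟩ : ∃ Ψ : EuclideanSpace ℝ (Fin 3) → ℝ → EuclideanSpace ℝ (Fin 3),
      Ψ = lipschitzFlow hVlip := ⟨_, rfl⟩
  have hΨ0 : ∀ q, Ψ q 0 = q := fun q => by rw [hΨ, lipschitzFlow_zero]
  have hΨd : ∀ q s, HasDerivAt (Ψ q) (V (Ψ q s)) s := fun q s => by
    rw [hΨ]; exact hasDerivAt_lipschitzFlow hVlip q s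
  have hΨadd : ∀ q s t, Ψ q (s + t) = Ψ (Ψ q s) t := fun q s t => by
    rw [hΨ]; exact lipschitzFlow_add hVlip q s t
  have hΨcont : ∀ t, Continuous fun q => Ψ q t := fun t => by
    rw [hΨ]; exact DecayFlux.continuous_flow_slice hVlip hVC1 t
  have hconst : ∀ q t, f (Ψ q t) = f q := by
    intro q t
    have hF : ∀ s, HasDerivAt (fun s => f (Ψ q s)) 0 s := by
      intro s
      have h1 := ((hf (Ψ q s)).hasFDerivAt).comp_hasDerivAt s (hΨd q s)
      rw [hVx, hfV] at h1
      exact h1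
    have h := is_const_of_deriv_eq_zero (fun s => (hF s).differentiableAt)
      (fun s => (hF s).deriv) t 0
    rw [hΨ0] at h
    exact h
  -- outward escape: `(‖Ψ q t - c‖² - 2B) e^{-t}` is non-decreasing
  obtain ⟨B, hB⟩ : ∃ B : ℝ, B = C * (1 + ‖c‖) := ⟨_, rfl⟩
  have hB0 : 0 ≤ B := by rw [hB]; positivity
  have hgrow : ∀ q, ∀ t : ℝ, 0 ≤ t →
      (‖q - c‖ ^ 2 - 2 * B) * Real.exp t ≤ ‖Ψ q t - c‖ ^ 2 - 2 * B := by
    intro q t ht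
    obtain ⟨φ, hφ⟩ : ∃ φ : ℝ → ℝ, φ = fun s => (‖Ψ q s - c‖ ^ 2 - 2 * B) * Real.exp (-s) :=
      ⟨_, rfl⟩
    have hφd : ∀ s, HasDerivAt φ ((2 * ⟪Ψ q s - c, V (Ψ q s)⟫ - (‖Ψ q s - c‖ ^ 2 - 2 * B)) *
        Real.exp (-s)) s := by
      intro s
      have h1 : HasDerivAt (fun s => ‖Ψ q s - c‖ ^ 2 - 2 * B) (2 * ⟪Ψ q s - c, V (Ψ q s)⟫) s := by
        have h := ((hΨd q s).sub_const c).norm_sq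
        simpa using h.sub_const (2 * B)
      have h2 : HasDerivAt (fun s => Real.exp (-s)) (-Real.exp (-s)) s := by
        simpa using ((hasDerivAt_id s).neg).exp
      have h3 := h1.mul h2
      rw [hφ]
      refine h3.congr_deriv ?_
      ring
    have hmono : Monotone φ := by
      refine monotone_of_deriv_nonneg (fun s => (hφd s).differentiableAt) fun s => ?_
      rw [(hφd s).deriv]
      refine mul_nonneg ?_ (Real.exp_pos _).le
      have h := SimilarityFlow.two_inner_ge (c := c) hC0 (fun y => (hC y).1) (Ψ q s)
      rw [hVx, hB]
      linarith
    have h := hmono ht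
    rw [hφ] at h
    simp only [neg_zero, Real.exp_zero, mul_one, hΨ0] at h
    have hexp : 0 < Real.exp t := Real.exp_pos t
    have h2 := mul_le_mul_of_nonneg_right h hexp.le
    rwa [mul_assoc, ← Real.exp_add, neg_add_cancel, Real.exp_zero, mul_one] at h2
  -- an orbit through a point outside the ball `‖y - c‖² ≤ 2B + 1` gives `f q = h`
  have hescape : ∀ q, 2 * B + 1 < ‖q - c‖ ^ 2 → f q = h := by
    intro q hq
    have htend : Tendsto (fun t : ℝ => Ψ q t) atTop (cocompact _) := by
      refine tendsto_cocompact_of_tendsto_dist_comp_atTop c ?_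
      have h1 : Tendsto (fun t : ℝ => (‖q - c‖ ^ 2 - 2 * B) * Real.exp t + 2 * B) atTop atTop := by
        refine tendsto_atTop_add_const_right _ _ ?_
        exact Tendsto.const_mul_atTop (by linarith) Real.tendsto_exp_atTop
      have h2 : Tendsto (fun t : ℝ => ‖Ψ q t - c‖ ^ 2) atTop atTop := by
        refine tendsto_atTop_mono' atTop ?_ h1
        filter_upwards [eventually_ge_atTop (0 : ℝ)] with t ht
        linarith [hgrow q t ht]
      have h3 : Tendsto (fun t : ℝ => ‖Ψ q t - c‖) atTop atTop := by
        have h4 := (tendsto_rpow_atTop (by norm_num : (0 : ℝ) < 1 / 2)).comp h2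
        refine h4.congr fun t => ?_
        simp only [Function.comp_apply]
        rw [← Real.sqrt_eq_rpow, Real.sqrt_sq (norm_nonneg _)]
      simpa [dist_eq_norm] using h3
    have h1 : Tendsto (fun t : ℝ => f (Ψ q t)) atTop (𝓝 h) := hlim.comp htend
    have h2 : Tendsto (fun t : ℝ => f (Ψ q t)) atTop (𝓝 (f q)) := by
      simp only [hconst]; exact tendsto_const_nhds
    exact tendsto_nhds_unique h2 h1
  have hescape' : ∀ q (t : ℝ), 2 * B + 1 < ‖Ψ q t - c‖ ^ 2 → f q = h := by
    intro q t hqt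
    rw [← hconst q t]
    exact hescape _ hqt
  -- the bounded forward-invariant set `Inv`
  obtain ⟨Inv, hInv⟩ : ∃ Inv : Set (EuclideanSpace ℝ (Fin 3)),
      Inv = {q | ∀ t : ℝ, 0 ≤ t → ‖Ψ q t - c‖ ^ 2 ≤ 2 * B + 1} := ⟨_, rfl⟩
  have hout : ∀ q, q ∉ Inv → f q = h := by
    intro q hq
    rw [hInv] at hq
    simp only [mem_setOf_eq, not_forall, not_le, exists_prop] at hq
    obtain ⟨t, -, ht⟩ := hq
    exact hescape' q t ht
  have hclosed : IsClosed Inv := by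
    have heq : Inv = ⋂ t : ℝ, ⋂ (_ : 0 ≤ t), {q | ‖Ψ q t - c‖ ^ 2 ≤ 2 * B + 1} := by
      rw [hInv]; ext q; simp
    rw [heq]
    refine isClosed_iInter fun t => isClosed_iInter fun _ => ?_
    exact isClosed_le (((hΨcont t).sub continuous_const).norm.pow 2) continuous_const
  have hbdd : Inv ⊆ closedBall c (Real.sqrt (2 * B + 1)) := by
    intro q hq
    rw [hInv] at hq
    have h0 := hq 0 le_rfl
    rw [hΨ0] at h0
    rw [mem_closedBall, dist_eq_norm, ← Real.sqrt_sq (norm_nonneg (q - c))]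
    exact Real.sqrt_le_sqrt h0
  have hsub : (fun q => lipschitzFlow hVlip q 1) '' Inv ⊆ Inv := by
    rw [← hΨ]
    rintro _ ⟨q, hq, rfl⟩
    rw [hInv] at hq ⊢
    intro t ht
    have h := hq (1 + t) (by linarith)
    rwa [hΨadd] at h
  have hnull : volume Inv = 0 := by
    refine DecayFlux.measure_eq_zero_of_image_flow_subset volume hVlip hVC1
      (by norm_num : (0 : ℝ) < 3 / 2) hVdiv one_pos hclosed.measurableSet ?_ hsub
    exact (lt_of_le_of_lt (measure_mono hbdd) measure_closedBall_lt_top).ne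
  -- density and continuity
  have hdense : Dense Invᶜ := by
    rw [← interior_eq_empty_iff_dense_compl]
    by_contra hne
    obtain ⟨x, hx⟩ := nonempty_iff_ne_empty.2 hne
    have hpos : 0 < volume (interior Inv) := isOpen_interior.measure_pos volume ⟨x, hx⟩
    have hle : volume (interior Inv) ≤ volume Inv := measure_mono interior_subset
    rw [hnull] at hle
    exact absurd hle (not_le.2 hpos)
  have hfeq : f = fun _ => h :=
    Continuous.ext_on hdense hf.continuous continuous_const fun q hq => hout q hq
  intro y
  rw [hfeq]

end Summit.NavierStokesRegularity.NavierStokesRegularity.Theorems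

end
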